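import Literature.Geometry.GaugeTheory.SeibergWittenConjugation
import Mathlib.Topology.Algebra.UniformConvergence
import Mathlib.Topology.Baire.BaireMeasurable
import Mathlib.SetTheory.Cardinal.SchroederBernstein
import Mathlib.SetTheory.Cardinal.Finite
import Mathlib.Analysis.Calculus.ContDiff.Operations
import Mathlib.Data.ZMod.Basic
import HarnessLib

/-!
# The Seiberg–Witten invariant modulo `2` of a `Spin^c` structure in expected dimension `0`
# (Taubes 1995, Def. 1.1; Morgan 1996, §6.7), the `C^∞` topology on perturbations, and the
# conjugation symmetry `SW(-P̃) ≡ SW(P̃)` (Morgan 1996, Cor. 6.8.4) — Čech form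

Topic `Literature/Geometry/GaugeTheory`; continues `SeibergWittenEquations` (`𝔰.Perturbation`,
`𝔰.Configuration` with its `C^∞` topology, the moduli space `𝔰.ModuliSpace η = {solutions}/𝒢`) and
`SeibergWittenConjugation` (`𝔰.conjugate = -P̃`, `𝔰.perturbationNeg η = -η`,
`ModuliSpace.conjugateMap : 𝓜(P̃, η) → 𝓜(-P̃, -η)`).

C. H. Taubes, *The Seiberg–Witten and Gromov invariants*, Math. Res. Lett. 2 (1995), §1:
p. 224, Fact 2: "When `b₂⁺ ≥ 1`, the space `M` will be a smooth manifold for a generic choice of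
`µ` in (1.7). (Here, generic means a Baire subset of `C^∞(Λ₊)`.)"; Fact 5: "The space `M` is
compact."; p. 225, **Definition 1.1**: "Let `X` be a compact, oriented 4-manifold with `b₂⁺ > 1`
and let `L ∈ Spin` be a `Spinᶜ` structure on `X` … a) When `d < 0` in (1.8), the invariant is
defined to be zero.  b) When `d = 0` in (1.8), choose `µ` in (1.7) to make `M` a smooth manifold.
Then this `M` is a finite union of signed points and the Seiberg–Witten invariant is the sum over
these points of the corresponding `±1`'s.  c) When `d > 0` …"; Prop. 1.2: `SW(L)` "is independent
of the choice of metric and perturbing form `µ`".  J. W. Morgan, *The Seiberg–Witten Equations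
and Applications to the Topology of Smooth Four-Manifolds* (1996), Thm. 6.1.1 ("for a generic
`C^∞` self-dual real two-form `h` … `𝓜(P̃, h)` … form a smooth compact submanifold of `𝓑*(P̃)` of
dimension `(c₁(𝓛)² - (2χ(X) + 3σ(X)))/4`"), §6.7 (the definition of `SW(P̃)` for `b₂⁺(X) > 1`,
Lemma 6.7.1: independence of `h` and of the metric), Thm. 6.8.3 and Cor. 6.8.4
(`SW(-P̃) = (-1)^{ε(X)} SW(P̃)`).

## What this file renders, and what it does not

The tree has the moduli SET `𝔰.ModuliSpace η` for every smooth self-dual perturbation `η` of a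
`Spin^c` structure `𝔰` on a Riemannian `4`-manifold `(X, g, o)` (fixed metric, as in Taubes's
Part 2 "Fix a Riemannian metric on `X`"), but none of the analysis of Facts 1–5 (transversality,
compactness, orientations).  Definition 1.1 (b) reads the invariant off ONE generic `µ`; to avoid
a choice we quantify over a Baire (residual) set of perturbations, exactly Taubes's meaning of
"generic" (Fact 2), and keep only the PARITY of the signed count, which needs no orientation:

* the **`C^∞` topology on `𝔰.Perturbation`** (local uniform convergence of the chart
  representatives of `η` with all derivatives — the topology of `C^∞(Λ₊)` in Fact 2), built from
  jets exactly as the topology of `𝔰.Configuration`;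
* `𝔰.HasGenericParity n` (`n : ZMod 2`): **the residual filter of perturbations is proper and for a
  residual set of perturbations `η` the moduli space `𝓜(𝔰, η)` is finite with
  `#𝓜(𝔰, η) ≡ n (mod 2)`** (the properness conjunct makes the predicate degenerate-safe: it is what a
  non-empty Baire space provides, and without it a degenerate topology would satisfy every parity);
* `𝔰.swInvariantModTwo : ZMod 2` — **the Seiberg–Witten invariant modulo `2` in expected dimension
  `≤ 0`**: `1` if `𝔰.HasGenericParity 1`, else `0` (so `0` for a degenerate topology).

By Facts 1–5 / Thm. 6.1.1 and Lemma 6.7.1, when `b₂⁺(X) > 1` and `d(L) = 0` the residual set of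
regular perturbations has finite moduli spaces whose signed count is `SW(L)`, so
`𝔰.HasGenericParity (SW(L) mod 2)` holds and `swInvariantModTwo` IS Definition 1.1 (b) modulo `2`;
when `d(L) < 0` the generic moduli space is empty and the value is `0`, Definition 1.1 (a).  SCOPE
CAVEATS (stated, not hidden): (i) case (c), `d > 0`, is NOT rendered — there the generic moduli
space is a closed manifold of positive dimension, `HasGenericParity` fails unless it is empty, and
the value `0` returned here is not Taubes's `∫ µ^{d/2}` (irrelevant for symplectic manifolds by
Taubes 1995, Prop. 4.3, "simple type", but a genuine restriction in general);
(ii) for `b₂⁺ = 1` the printed invariant depends on a chamber and no residual set need have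
constant parity; (iii) none of the identifications just quoted is asserted in this file — they are
the content of Seiberg–Witten theory (Taubes's Facts 1–5, Prop. 1.2), absent from the tree; the
definition only NAMES the quantity those theorems are about, so that Taubes 1994 (`SW = ±1` for
the canonical structure of a symplectic manifold) and Taubes 1995, Prop. 4.2 (`SW ≠ 0 ⇒`
symplectic curves) can be stated in the tree's vocabulary.  TODO(general form): the `ℤ`-valued
invariant (orientation of `𝓜` from `det(H⁰ ⊗ H¹ ⊗ H²₊)`, Fact 3) and case (c).

PROVED here (0 named facts): extensionality of perturbations; continuity of the jets; `η ↦ -η` is a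
HOMEOMORPHISM `𝔰.Perturbation ≃ₜ 𝔰.conjugate.Perturbation` (`perturbationNegHomeomorph`; jets of
`-η` are the negatives); **`ModuliSpace.conjugateMap` is injective** (a gauge equivalence
`(A*, ιψ) ~ (A'*, ιψ')` conjugates back to `(A, ψ) ~ (A', ψ')`, `GaugeRel.of_conjugate`) and
**`𝓜(P̃, η) ≃ 𝓜(-P̃, -η)`** (`nonempty_moduliSpace_equiv_conjugate`, Morgan Thm. 6.8.3 "induces a
homeomorphism of the moduli spaces `𝓜(P̃, h) → 𝓜(-P̃, -h)`", here as a bijection, from the two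
injections `𝓜(P̃, η) ↪ 𝓜(-P̃, -η) ↪ 𝓜(P̃, η)` and `-(-P̃) = P̃`); uniqueness of the generic parity
(`HasGenericParity.unique`: two residual sets of a proper residual filter meet; the `C^∞` topology
is completely metrisable, hence Baire — not proved here, so properness `(residual 𝔰.Perturbation).NeBot`
is a CONJUNCT of `HasGenericParity`, supplied by `residual_neBot_of_baireSpace` once `BaireSpace` is
available); `swInvariantModTwo = n` from `HasGenericParity n`;
**non-vanishing forces solutions**: `swInvariantModTwo 𝔰 ≠ 0 →` the residual filter is proper and for a
residual set of `η` the moduli space `𝓜(𝔰, η)` is non-empty, in particular some (a dense set of) `η`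
have solutions (`eventually_nonempty_moduliSpace_of_swInvariantModTwo_ne_zero`,
`exists_nonempty_…` — the form in which a non-zero invariant is USED in Taubes 1995, §5, Part 1); and
**conjugation invariance**
`𝔰.conjugate.HasGenericParity n ↔ 𝔰.HasGenericParity n`,
`𝔰.conjugate.swInvariantModTwo = 𝔰.swInvariantModTwo` — Morgan's Cor. 6.8.4
`SW(-P̃) = (-1)^{ε(X)} SW(P̃)` read modulo `2`, i.e. Taubes 1995, §2 (p. 226): "the Seiberg–Witten
invariant for `E` and for `K ⊗ E⁻¹` are equal in absolute magnitude" (for the structures (2.2),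
`-P̃_E = P̃_{K ⊗ E⁻¹}`), unconditionally for the rendered quantity.

## References

* C. H. Taubes, *The Seiberg–Witten and Gromov invariants*, Math. Res. Lett. 2 (1995) 221–238,
  §1 (Facts 1–5, Def. 1.1, Prop. 1.2), §2 (p. 226), §5. [Taubes1995]
* J. W. Morgan, *The Seiberg–Witten Equations and Applications to the Topology of Smooth
  Four-Manifolds*, Princeton Math. Notes 44 (1996), Thm. 6.1.1, §6.7 (Lemma 6.7.1, Thm. 6.7.3),
  §6.8 (Thm. 6.8.3, Cor. 6.8.4). [MorganSWBook1996]
-/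

noncomputable section

open scoped Manifold ContDiff Topology ComplexConjugate UniformConvergence
open Set Function Filter Complex
open Literature.Geometry.Lorentzian (PseudoRiemannianMetric)
open Literature.Topology.FourManifolds (SmoothOrientation)
open Literature.Geometry.Kaehler (MForm IsSmoothForm)

namespace Literature.Geometry.GaugeTheory

/-- Local notation: the model space `ℝ⁴`. -/
local notation "𝔼⁴" => EuclideanSpace ℝ (Fin 4)

/-- In a non-empty Baire space the residual filter is proper (every residual set is dense, hence
non-empty). [folklore] -/
theorem residual_neBot_of_baireSpace {Y : Type*} [TopologicalSpace Y] [BaireSpace Y] [Nonempty Y] :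
    (residual Y).NeBot :=
  Filter.forall_mem_nonempty_iff_neBot.1 fun _ hs ↦ (dense_of_mem_residual hs).nonempty

variable {X : Type*} [TopologicalSpace X] [ChartedSpace 𝔼⁴ X] [IsManifold (𝓡 4) ∞ X]
  {g : PseudoRiemannianMetric (𝓡 4) ∞ 𝔼⁴ (TangentSpace (𝓡 4) : X → Type _)}
  {o : SmoothOrientation (𝓡 4) X} {ι : Type*}

namespace SpincStructure

variable {𝔰 : SpincStructure g o ι}

/-! ### Perturbations: extensionality and the `C^∞` topology -/

namespace Perturbation

/-- Two perturbations with the same `2`-form are equal. [folklore] -/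
@[ext] theorem ext {η₁ η₂ : 𝔰.Perturbation} (h : η₁.form = η₂.form) : η₁ = η₂ := by
  cases η₁; cases η₂; cases h; rfl

variable (𝔰) in
/-- **The `m`-jet of the chart representative of `η`** in the chart at `x₀`, in the space of functions
with the topology of uniform convergence on the compact sets `𝔰.swJetDomains i x₀` (as
`Configuration.connJet`). [cite: Taubes1995, §1 Fact 2] -/
def jet (η : 𝔰.Perturbation) (i : ι) (x₀ : X) (m : ℕ) :
    𝔼⁴ →ᵤ[𝔰.swJetDomains i x₀] (𝔼⁴ [×m]→L[ℝ] (𝔼⁴ [⋀^Fin 2]→L[ℝ] ℝ)) :=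
  UniformOnFun.ofFun (𝔰.swJetDomains i x₀)
    (iteratedFDerivWithin ℝ m (η.form.inChart x₀) (range (𝓡 4)))

/-- Unfolding `jet`. [folklore] -/
theorem jet_eq (η : 𝔰.Perturbation) (i : ι) (x₀ : X) (m : ℕ) :
    jet 𝔰 η i x₀ m = UniformOnFun.ofFun (𝔰.swJetDomains i x₀)
      (iteratedFDerivWithin ℝ m (η.form.inChart x₀) (range (𝓡 4))) :=
  rfl

/-- **The `C^∞` topology on perturbations** — Taubes's `C^∞(Λ₊)` (Fact 2): the coarsest topology
making all jets of the chart representatives of `η` (every chart `i`, centre `x₀`, order `m`)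
continuous for uniform convergence on compact subsets of chart images, i.e. local uniform
convergence of `η` with all derivatives (cf. `Configuration.instTopologicalSpace`).
[cite: Taubes1995, §1 Fact 2] -/
instance instTopologicalSpace : TopologicalSpace 𝔰.Perturbation :=
  ⨅ i : ι, ⨅ x₀ : X, ⨅ m : ℕ,
    TopologicalSpace.induced (fun η : 𝔰.Perturbation ↦ jet 𝔰 η i x₀ m) inferInstance

/-- Each jet is continuous. [folklore] -/
theorem continuous_jet (i : ι) (x₀ : X) (m : ℕ) : Continuous fun η : 𝔰.Perturbation ↦ jet 𝔰 η i x₀ m :=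
  continuous_iInf_dom (continuous_iInf_dom (continuous_iInf_dom continuous_induced_dom))

/-- A map into perturbations is continuous as soon as all its jets are. [folklore] -/
theorem continuous_of_jet {Y : Type*} [TopologicalSpace Y] {f : Y → 𝔰.Perturbation}
    (h : ∀ i x₀ m, Continuous fun y ↦ jet 𝔰 (f y) i x₀ m) : Continuous f :=
  continuous_iInf_rng.2 fun i ↦ continuous_iInf_rng.2 fun x₀ ↦ continuous_iInf_rng.2 fun m ↦
    continuous_induced_rng.2 (h i x₀ m)

/-- The jets of `-η`-type forms: `iteratedFDerivWithin` of `(-1) • F` on `range (𝓡 4) = ℝ⁴` is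
`(-1) •` that of `F` (negation needs no differentiability). [folklore] -/
theorem ofFun_iteratedFDerivWithin_neg_one_smul (𝔖 : Set (Set 𝔼⁴)) (F : 𝔼⁴ → 𝔼⁴ [⋀^Fin 2]→L[ℝ] ℝ)
    (m : ℕ) :
    UniformOnFun.ofFun 𝔖 (iteratedFDerivWithin ℝ m ((-1 : ℝ) • F) (range (𝓡 4))) =
      (-1 : ℝ) • UniformOnFun.ofFun 𝔖 (iteratedFDerivWithin ℝ m F (range (𝓡 4))) := by
  rw [show ((-1 : ℝ) • F) = -F from neg_one_smul ℝ F, ModelWithCorners.Boundaryless.range_eq_univ,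
    iteratedFDerivWithin_univ, iteratedFDerivWithin_univ, iteratedFDeriv_neg,
    ← neg_one_smul ℝ (iteratedFDeriv ℝ m F), UniformOnFun.ofFun_smul]

end Perturbation

/-! ### `η ↦ -η` is a homeomorphism `Perturbation(P̃) ≃ₜ Perturbation(-P̃)` -/

/-- The form of `-η` is `(-1) • η`. [cite: MorganSWBook1996, Thm. 6.8.3] -/
@[simp] theorem perturbationNeg_form (η : 𝔰.Perturbation) : (𝔰.perturbationNeg η).form = (-1 : ℝ) • η.form :=
  rfl

/-- The jets of `-η` are `(-1) •` the jets of `η`. [folklore] -/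
theorem jet_perturbationNeg (η : 𝔰.Perturbation) (i : ι) (x₀ : X) (m : ℕ) :
    Perturbation.jet 𝔰.conjugate (𝔰.perturbationNeg η) i x₀ m = (-1 : ℝ) • Perturbation.jet 𝔰 η i x₀ m := by
  rw [Perturbation.jet_eq, Perturbation.jet_eq, perturbationNeg_form, MForm.inChart_smul]
  exact Perturbation.ofFun_iteratedFDerivWithin_neg_one_smul _ _ _

/-- `η ↦ -η` is continuous for the `C^∞` topologies. [folklore] -/
theorem continuous_perturbationNeg : Continuous 𝔰.perturbationNeg :=
  Perturbation.continuous_of_jet fun i x₀ m ↦ by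
    simp only [jet_perturbationNeg]
    exact (Perturbation.continuous_jet i x₀ m).const_smul (-1 : ℝ)

variable (𝔰) in
/-- **The inverse `-η' ↤ η'`**: a perturbation of `-P̃` negated is a perturbation of `P̃` (the frames
of `-P̃` are those of `P̃`). [cite: MorganSWBook1996, Thm. 6.8.3] -/
def perturbationNegInv (η' : 𝔰.conjugate.Perturbation) : 𝔰.Perturbation :=
  ⟨(𝔰.conjugate.perturbationNeg η').form, (𝔰.conjugate.perturbationNeg η').isSmoothForm,
    (𝔰.conjugate.perturbationNeg η').isSelfDual⟩

/-- The form of the inverse image is `(-1) • η'`. [folklore] -/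
@[simp] theorem perturbationNegInv_form (η' : 𝔰.conjugate.Perturbation) :
    (𝔰.perturbationNegInv η').form = (-1 : ℝ) • η'.form :=
  rfl

/-- The jets of `-η'` are `(-1) •` the jets of `η'`. [folklore] -/
theorem jet_perturbationNegInv (η' : 𝔰.conjugate.Perturbation) (i : ι) (x₀ : X) (m : ℕ) :
    Perturbation.jet 𝔰 (𝔰.perturbationNegInv η') i x₀ m =
      (-1 : ℝ) • Perturbation.jet 𝔰.conjugate η' i x₀ m := by
  rw [Perturbation.jet_eq, Perturbation.jet_eq, perturbationNegInv_form, MForm.inChart_smul]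
  exact Perturbation.ofFun_iteratedFDerivWithin_neg_one_smul _ _ _

/-- The inverse map is continuous. [folklore] -/
theorem continuous_perturbationNegInv : Continuous 𝔰.perturbationNegInv :=
  Perturbation.continuous_of_jet fun i x₀ m ↦ by
    simp only [jet_perturbationNegInv]
    exact (Perturbation.continuous_jet i x₀ m).const_smul (-1 : ℝ)

/-- `-(-η) = η`. [folklore] -/
@[simp] theorem perturbationNegInv_perturbationNeg (η : 𝔰.Perturbation) :
    𝔰.perturbationNegInv (𝔰.perturbationNeg η) = η :=
  Perturbation.ext (by simp)

/-- `-(-η') = η'`. [folklore] -/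
@[simp] theorem perturbationNeg_perturbationNegInv (η' : 𝔰.conjugate.Perturbation) :
    𝔰.perturbationNeg (𝔰.perturbationNegInv η') = η' :=
  Perturbation.ext (by simp)

variable (𝔰) in
/-- **`η ↦ -η` is a homeomorphism `C^∞(Λ₊) → C^∞(Λ₊)` between the perturbations of `P̃` and of
`-P̃`** (so it preserves residual sets). [cite: MorganSWBook1996, Thm. 6.8.3] -/
def perturbationNegHomeomorph : 𝔰.Perturbation ≃ₜ 𝔰.conjugate.Perturbation where
  toFun := 𝔰.perturbationNeg
  invFun := 𝔰.perturbationNegInv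
  left_inv := perturbationNegInv_perturbationNeg
  right_inv := perturbationNeg_perturbationNegInv
  continuous_toFun := continuous_perturbationNeg
  continuous_invFun := continuous_perturbationNegInv

/-- The homeomorphism is `η ↦ -η`. [folklore] -/
@[simp] theorem perturbationNegHomeomorph_apply (η : 𝔰.Perturbation) :
    𝔰.perturbationNegHomeomorph η = 𝔰.perturbationNeg η :=
  rfl

/-! ### `𝓜(P̃, η) ≃ 𝓜(-P̃, -η)` (Morgan 1996, Thm. 6.8.3) -/

section Moduli

variable [g.HasLeviCivita]

omit [g.HasLeviCivita] in
/-- **A gauge equivalence between conjugates comes from a gauge equivalence**: if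
`(A*, ιψ) ~ (A'*, ιψ')` through `σ` then `(A, ψ) ~ (A', ψ')` through `σ⁻¹ = σ̄` (conjugate the two
defining identities; `ι` is antilinear with `ι² = -1`). [cite: MorganSWBook1996, Thm. 6.8.3] -/
theorem GaugeRel.of_conjugate {c c' : 𝔰.Configuration} (h : GaugeRel c.conjugate c'.conjugate) :
    GaugeRel c c' := by
  obtain ⟨σ, hA, hψ⟩ := h
  refine ⟨σ⁻¹, fun i x hx v ↦ ?_, fun i x hx ↦ ?_⟩
  · have h1 := hA i x hx v
    simp only [Configuration.conjugate_conn, connectionConj_form_apply, Complex.ofReal_neg, mul_neg] at h1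
    rw [SpincGauge.logDeriv_inv]
    linear_combination -h1
  · have h2 := congr_arg spinorConjVec (hψ i x hx)
    change spinorConjVec (spinorConjVec (c'.spinor.toFun i x)) =
      spinorConjVec (conj (σ.toFun x) • spinorConjVec (c.spinor.toFun i x)) at h2
    rw [spinorConjVec_smul, Complex.conj_conj, spinorConjVec_spinorConjVec, spinorConjVec_spinorConjVec,
      smul_neg, neg_inj] at h2
    rw [h2, SpincGauge.inv_toFun, Complex.conj_conj]

/-- **The map `𝓜(P̃, η) → 𝓜(-P̃, -η)` is injective.** [cite: MorganSWBook1996, Thm. 6.8.3] -/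
theorem ModuliSpace.conjugateMap_injective (η : 𝔰.Perturbation) :
    Function.Injective (ModuliSpace.conjugateMap η) := by
  intro p q hpq
  obtain ⟨c, rfl⟩ := ModuliSpace.mk_surjective p
  obtain ⟨c', rfl⟩ := ModuliSpace.mk_surjective q
  rw [ModuliSpace.conjugateMap_mk, ModuliSpace.conjugateMap_mk, ModuliSpace.mk_eq_mk_iff] at hpq
  exact ModuliSpace.mk_eq_mk_of_gaugeRel (GaugeRel.of_conjugate hpq)

/-- Moduli spaces of equal `Spin^c` structures and perturbations with equal forms are in bijection
(transport of structure). [folklore] -/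
theorem nonempty_moduliSpace_equiv_of_eq {𝔰₁ 𝔰₂ : SpincStructure g o ι}
    (h : 𝔰₁ = 𝔰₂) (η₁ : 𝔰₁.Perturbation) (η₂ : 𝔰₂.Perturbation) (hη : η₁.form = η₂.form) :
    Nonempty (𝔰₁.ModuliSpace η₁ ≃ 𝔰₂.ModuliSpace η₂) := by
  subst h
  obtain rfl : η₁ = η₂ := Perturbation.ext hη
  exact ⟨Equiv.refl _⟩

/-- **`𝓜(P̃, η) ≃ 𝓜(-P̃, -η)`** (Morgan 1996, Thm. 6.8.3: the involution "induces a homeomorphism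
of the moduli spaces"; here the bijection, by Schröder–Bernstein from the injections
`𝓜(P̃, η) ↪ 𝓜(-P̃, -η) ↪ 𝓜(-(-P̃), -(-η)) = 𝓜(P̃, η)`). [cite: MorganSWBook1996, Thm. 6.8.3] -/
theorem nonempty_moduliSpace_equiv_conjugate (η : 𝔰.Perturbation) :
    Nonempty (𝔰.ModuliSpace η ≃ 𝔰.conjugate.ModuliSpace (𝔰.perturbationNeg η)) := by
  obtain ⟨e⟩ := nonempty_moduliSpace_equiv_of_eq 𝔰.conj_conj
    (𝔰.conjugate.perturbationNeg (𝔰.perturbationNeg η)) η (by simp)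
  exact Function.Embedding.antisymm ⟨_, ModuliSpace.conjugateMap_injective η⟩
    ⟨e ∘ ModuliSpace.conjugateMap (𝔰.perturbationNeg η),
      e.injective.comp (ModuliSpace.conjugateMap_injective _)⟩

/-- `𝓜(P̃, η)` is finite iff `𝓜(-P̃, -η)` is. [cite: MorganSWBook1996, Thm. 6.8.3] -/
theorem finite_moduliSpace_conjugate_iff (η : 𝔰.Perturbation) :
    Finite (𝔰.conjugate.ModuliSpace (𝔰.perturbationNeg η)) ↔ Finite (𝔰.ModuliSpace η) := by
  obtain ⟨e⟩ := nonempty_moduliSpace_equiv_conjugate η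
  exact ⟨fun _ ↦ Finite.of_equiv _ e.symm, fun _ ↦ Finite.of_equiv _ e⟩

/-- `#𝓜(-P̃, -η) = #𝓜(P̃, η)`. [cite: MorganSWBook1996, Thm. 6.8.3] -/
theorem card_moduliSpace_conjugate (η : 𝔰.Perturbation) :
    Nat.card (𝔰.conjugate.ModuliSpace (𝔰.perturbationNeg η)) = Nat.card (𝔰.ModuliSpace η) := by
  obtain ⟨e⟩ := nonempty_moduliSpace_equiv_conjugate η
  exact (Nat.card_congr e).symm

end Moduli

/-! ### The invariant modulo `2` -/

section Invariant

variable [g.HasLeviCivita]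

variable (𝔰) in
/-- **Generic parity of the moduli spaces**: the residual filter of `C^∞(Λ₊)` is proper (residual
sets are non-empty, as in a non-empty Baire space — part of Taubes's "generic means a Baire subset",
Fact 2, and what makes the next clause non-vacuous) AND for a residual set of smooth self-dual
perturbations `η` the moduli space `𝓜(𝔰, η)` is a finite set with `#𝓜(𝔰, η) ≡ n (mod 2)` — the
parity of the count of Definition 1.1 (b) (`d = 0`: "this `M` is a finite union of signed points"),
resp. `n = 0` in case (a) (`d < 0`, generically empty).  A predicate on `(𝔰, n)`; nothing is
asserted.  (Degenerate-safe: were the `C^∞` topology not Baire and its residual filter `⊥`, NO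
parity would hold, rather than every parity.) [cite: Taubes1995, Def. 1.1 and §1 Fact 2]
[cite: MorganSWBook1996, Thm. 6.1.1 and §6.7] -/
def HasGenericParity (n : ZMod 2) : Prop :=
  (residual 𝔰.Perturbation).NeBot ∧
    ∀ᶠ η in residual 𝔰.Perturbation,
      Finite (𝔰.ModuliSpace η) ∧ ((Nat.card (𝔰.ModuliSpace η) : ZMod 2) = n)

variable (𝔰) in
/-- **The Seiberg–Witten invariant modulo `2` of the `Spin^c` structure `𝔰` on `(X, g, o)` in
expected dimension `≤ 0`** (Taubes 1995, Def. 1.1 (a)–(b), read modulo `2`; Morgan 1996, §6.7):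
`1` if the residual filter of perturbations is proper and the generic moduli space is a finite set
of odd cardinality, `0` otherwise (in particular `0` for a degenerate, non-Baire topology of
perturbations).  See the module docstring for the exact scope (fixed metric; case (c) `d > 0` and
the chambers of `b₂⁺ = 1` are not rendered). [cite: Taubes1995, Def. 1.1] [cite: MorganSWBook1996, §6.7] -/
def swInvariantModTwo : ZMod 2 :=
  open Classical in if 𝔰.HasGenericParity 1 then 1 else 0

/-- Unfolding `HasGenericParity`. [cite: Taubes1995, Def. 1.1] -/
theorem hasGenericParity_iff (n : ZMod 2) :
    𝔰.HasGenericParity n ↔ (residual 𝔰.Perturbation).NeBot ∧ ∀ᶠ η in residual 𝔰.Perturbation,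
      Finite (𝔰.ModuliSpace η) ∧ ((Nat.card (𝔰.ModuliSpace η) : ZMod 2) = n) :=
  Iff.rfl

/-- A generic parity makes the residual filter proper. [cite: Taubes1995, §1 Fact 2] -/
theorem HasGenericParity.neBot {n : ZMod 2} (h : 𝔰.HasGenericParity n) : (residual 𝔰.Perturbation).NeBot :=
  h.1

/-- The residual clause of a generic parity. [cite: Taubes1995, Def. 1.1] -/
theorem HasGenericParity.eventually {n : ZMod 2} (h : 𝔰.HasGenericParity n) :
    ∀ᶠ η in residual 𝔰.Perturbation,
      Finite (𝔰.ModuliSpace η) ∧ ((Nat.card (𝔰.ModuliSpace η) : ZMod 2) = n) :=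
  h.2

/-- Building a generic parity in a space of perturbations with proper residual filter (e.g. a
non-empty Baire space, `residual_neBot_of_baireSpace`). [cite: Taubes1995, §1 Fact 2] -/
theorem HasGenericParity.of_eventually [(residual 𝔰.Perturbation).NeBot] {n : ZMod 2}
    (h : ∀ᶠ η in residual 𝔰.Perturbation,
      Finite (𝔰.ModuliSpace η) ∧ ((Nat.card (𝔰.ModuliSpace η) : ZMod 2) = n)) :
    𝔰.HasGenericParity n :=
  ⟨‹_›, h⟩

/-- **The generic parity is unique** (two residual sets of a proper residual filter meet).
[cite: Taubes1995, §1 Fact 2] -/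
theorem HasGenericParity.unique {m n : ZMod 2} (hm : 𝔰.HasGenericParity m) (hn : 𝔰.HasGenericParity n) :
    m = n := by
  haveI := hm.neBot
  obtain ⟨η, ⟨-, hηm⟩, -, hηn⟩ := (hm.eventually.and hn.eventually).exists
  rw [← hηm, ← hηn]

/-- `swInvariantModTwo = 1` iff the generic parity is odd. [cite: Taubes1995, Def. 1.1] -/
theorem swInvariantModTwo_eq_one_iff : 𝔰.swInvariantModTwo = 1 ↔ 𝔰.HasGenericParity 1 := by
  unfold swInvariantModTwo
  split_ifs with h
  · simp [h]
  · simp only [h, iff_false]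
    decide

/-- `swInvariantModTwo = 0` unless the generic parity is odd. [cite: Taubes1995, Def. 1.1] -/
theorem swInvariantModTwo_eq_zero_of_not (h : ¬𝔰.HasGenericParity 1) : 𝔰.swInvariantModTwo = 0 := by
  unfold swInvariantModTwo
  rw [if_neg h]

/-- **A degenerate topology of perturbations gives `0`** (no junk value `1`): if the residual filter
is `⊥` the invariant vanishes. [folklore] -/
theorem swInvariantModTwo_eq_zero_of_not_neBot (h : ¬(residual 𝔰.Perturbation).NeBot) :
    𝔰.swInvariantModTwo = 0 :=
  swInvariantModTwo_eq_zero_of_not fun h1 ↦ h h1.neBot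

/-- **Definition 1.1 (a)–(b) modulo `2`**: if the generic moduli space is finite of parity `n`, the
invariant is `n` (for `n = 0` this uses the uniqueness of the generic parity).
[cite: Taubes1995, Def. 1.1] [cite: MorganSWBook1996, §6.7] -/
theorem swInvariantModTwo_of_hasGenericParity {n : ZMod 2} (h : 𝔰.HasGenericParity n) :
    𝔰.swInvariantModTwo = n := by
  unfold swInvariantModTwo
  split_ifs with h1
  · exact h1.unique h
  · have hn : n ≠ 1 := fun hn ↦ h1 (hn ▸ h)
    fin_cases n
    · rfl
    · exact absurd rfl hn

/-- **A generically empty moduli space has invariant `0`** (in particular Definition 1.1 (a)).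
[cite: Taubes1995, Def. 1.1] -/
theorem swInvariantModTwo_eq_zero_of_eventually_isEmpty
    (h : ∀ᶠ η in residual 𝔰.Perturbation, IsEmpty (𝔰.ModuliSpace η)) : 𝔰.swInvariantModTwo = 0 := by
  by_cases hbot : (residual 𝔰.Perturbation).NeBot
  · exact swInvariantModTwo_of_hasGenericParity ⟨hbot, h.mono fun η hη ↦
      ⟨Finite.of_subsingleton, by rw [Nat.card_of_isEmpty, Nat.cast_zero]⟩⟩
  · exact swInvariantModTwo_eq_zero_of_not_neBot hbot

/-- **A non-zero invariant forces solutions**: if `swInvariantModTwo 𝔰 ≠ 0` then the residual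
filter of perturbations is proper and for a residual set of perturbations `η` the moduli space
`𝓜(𝔰, η)` is non-empty — the way a non-vanishing Seiberg–Witten invariant is used in Taubes 1995,
§5, Part 1 (solutions of (5.2) for every large `r`). [cite: Taubes1995, Def. 1.1 and §5] -/
theorem eventually_nonempty_moduliSpace_of_swInvariantModTwo_ne_zero (h : 𝔰.swInvariantModTwo ≠ 0) :
    (residual 𝔰.Perturbation).NeBot ∧ ∀ᶠ η in residual 𝔰.Perturbation, Nonempty (𝔰.ModuliSpace η) := by
  have h1 : 𝔰.HasGenericParity 1 := by
    by_contra h1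
    exact h (swInvariantModTwo_eq_zero_of_not h1)
  refine ⟨h1.neBot, h1.eventually.mono fun η hη ↦ ?_⟩
  by_contra hne
  haveI : IsEmpty (𝔰.ModuliSpace η) := not_nonempty_iff.1 hne
  have h01 := hη.2
  rw [Nat.card_of_isEmpty, Nat.cast_zero] at h01
  exact zero_ne_one h01

/-- In particular a non-zero invariant gives a perturbation with a solution of `(SW_η)` (indeed a
dense set of them). [cite: Taubes1995, Def. 1.1 and §5] -/
theorem exists_nonempty_moduliSpace_of_swInvariantModTwo_ne_zero (h : 𝔰.swInvariantModTwo ≠ 0) :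
    ∃ η : 𝔰.Perturbation, Nonempty (𝔰.ModuliSpace η) := by
  obtain ⟨hbot, hev⟩ := eventually_nonempty_moduliSpace_of_swInvariantModTwo_ne_zero h
  exact hev.exists

/-! ### Conjugation invariance (Morgan 1996, Cor. 6.8.4, modulo `2`) -/

/-- **The generic parity is conjugation invariant**: `-η` runs through a residual set of
perturbations of `-P̃` as `η` runs through one of `P̃` (`η ↦ -η` is a homeomorphism, so it also
transports properness of the residual filter), and `#𝓜(-P̃, -η) = #𝓜(P̃, η)`.
[cite: MorganSWBook1996, Thm. 6.8.3 and Cor. 6.8.4] -/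
theorem HasGenericParity.conjugate {n : ZMod 2} (h : 𝔰.HasGenericParity n) : 𝔰.conjugate.HasGenericParity n := by
  obtain ⟨hbot, hev⟩ := h
  refine ⟨?_, ?_⟩
  · rw [← 𝔰.perturbationNegHomeomorph.residual_map_eq]
    exact hbot.map _
  · rw [← 𝔰.perturbationNegHomeomorph.residual_map_eq, Filter.eventually_map]
    refine hev.mono fun η hη ↦ ?_
    rw [perturbationNegHomeomorph_apply, finite_moduliSpace_conjugate_iff, card_moduliSpace_conjugate]
    exact hη

/-- `-P̃` and `P̃` have the same generic parities. [cite: MorganSWBook1996, Cor. 6.8.4] -/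
theorem hasGenericParity_conjugate_iff (n : ZMod 2) : 𝔰.conjugate.HasGenericParity n ↔ 𝔰.HasGenericParity n := by
  refine ⟨fun h ↦ ?_, fun h ↦ h.conjugate⟩
  have h' := h.conjugate
  rwa [conj_conj] at h'

/-- **`SW(-P̃) ≡ SW(P̃) (mod 2)`** for the rendered invariant (Morgan 1996, Cor. 6.8.4
`SW(-P̃) = (-1)^{ε(X)} SW(P̃)`; Taubes 1995, §2: the invariants of `E` and of `K ⊗ E⁻¹` "are equal
in absolute magnitude"). [cite: MorganSWBook1996, Cor. 6.8.4] [cite: Taubes1995, §2 (p. 226)] -/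
theorem swInvariantModTwo_conjugate : 𝔰.conjugate.swInvariantModTwo = 𝔰.swInvariantModTwo := by
  unfold swInvariantModTwo
  rw [hasGenericParity_conjugate_iff]

end Invariant

end SpincStructure

end Literature.Geometry.GaugeTheory

end
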